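import Summits.ABC.IUTFork.Joshi.ArithTeichmullerSpace
import Mathlib.Topology.Algebra.Module.Equiv
import HarnessLib

/-!
# Joshi, *Arithmetic Teichmüller spaces I* — the degree-one points of the Fargues–Fontaine curve, `𝒢(𝒪_F)`,
# and the ACTION of `Aut_{𝒪_E}(𝒢(𝒪_F))` on `𝔍(X,E)_F` ("many copies with distinct arithmetic"); the `Aut(Π)`-action

Record file of the abc-iut cell, branch E (seat abc-iut-E-t1; rung LADDER-ABC:A2.E); sequel to
`ArithTeichmullerSpace` (`Untilt`, `ATSObj X` = objects of `𝔍(X,E)`). TAKES NO SIDE on [IUTchIII] Cor. 3.12 or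
on any author; typed ≠ proved ≠ endorsed. Source: K. Joshi, arXiv 2106.11452 (unrefereed; the cell's render
`HOME/lit/renders/Joshi-arxiv-2106.11452/`, TeX labels and chunk numbers as locators), §8 Thm (th:main3)
(chunks p0021–p0022), §9 Cor (co:action-on-cpt-cat) (chunk p0025), §8 Prop (pr:belyi) + Cor (chunks p0020,
p0022). [claim: Joshi2021ATS1, status: disputed]

WHAT IS TYPED:
* §1 `unitRel`, `ProjPoints 𝒪E G = (G − {0})/𝒪E^*` and `projAct σ` — the action of an `𝒪E`-linear automorphism
  `σ` of `G` on it (DEFINED: `σ` preserves `≠ 0` and commutes with the units), `projAct_one`, `projAct_mul`.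
* §2 `UntiltPoints p 𝒪E` — SIGNATURE: "closed points of degree one" `|𝒴_{F,E}|` of the Fargues–Fontaine curve
  of a FIXED algebraically closed perfectoid `F` of characteristic `p` and the base field `E` (ring of
  integers `𝒪E`; `ℤ_p` for `E = ℚ_p`, Joshi's main case), their residue fields `K_y` (untilts of `F`
  receiving `E`: proof of Thm (th:main3) (5) [FarguesFontaine2018]), the Frobenius `φ`, the preferred algebraic
  closure of `E` in each `K_y` (chunk p0019) identified with the tree's `AlgebraicClosure ℚ_[p]` (a CHOICE up
  to `G_{ℚ_p}`, flagged as the datum `algCl`), the `𝒪E`-module `𝒢(𝒪_F)` of a Lubin–Tate group, and Thm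
  (th:main3) (3) "`|𝒴_{F,E}| = (𝒢(𝒪_F) − {0})/𝒪_E^*`" [FarguesFontaine2018] as the DATUM `ptEquiv`. From it:
  `ptAct` = Thm (th:main3) (3) "a natural action of `Aut_{𝒪_E}(𝒢(𝒪_F))` [the TOPOLOGICAL `𝒪_E`-linear
  automorphisms: `G ≃L[𝒪E] G`] … on the set of closed points of degree one" (DEFINED by transport), `ptAct_one`,
  `ptAct_mul`; item (4) (the induced map on `|𝒳_{F,E}| = |𝒴_{F,E}|/φ^ℤ`, defined in print on representatives) is NOT typed.
  Joshi's / the cited ASSERTIONS are named `Prop`s, never asserted: `ExistsNonIsomorphic` ([KedlayaTemkin2018];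
  §3 chunk p0008 "Crucial point for this paper is that there exist untilts of `ℂ_p^♭` which are not
  topologically isomorphic"), `FrobPreservesUntilt` (`K_{φ(y)} ≅ K_y`, implicit in "`|𝒴|/φ^ℤ ≅ |𝒳|`", chunk
  p0021), `ActionChangesTopology` (§1 chunk p0005: the action "moves the `ℚ_p`-isomorphism class of the
  analytic space … by changing the overfield `K` topologically (in general) while keeping `K^♭ = ℂ_p^♭`"),
  `IsDilatation` / `ActionDilates` (§10 (pa:norm-example) chunk p0026 = §1 chunk p0003: moving the untilt DILATES
  the valuation of `Q̄_p` by a factor `r`; plan/E OBJECTS row O-003), with `norm_p_ne_of_isDilatation` (`r ≠ 1`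
  changes `‖p‖`: the move is not isometric on constants).
* §3 `ATSObjF X D` — objects of **`𝔍(X,E)_F`** (§8 chunk p0019: "(Y/E′, E′ ↪ K, ι : K^♭ ≅ F)") typed as
  objects over a POINT `y` (so `K = K_y` and `ι` is the point); `toObj` (the full subcategory inclusion into
  `𝔍(X,E)`); **`ATSObjF.act σ`** = Thm (th:main3) (6) / Cor (co:action-on-cpt-cat): "`(Y/E′, E′ ↪ K_y) ↦
  (Y/E′, E′ ↪ K_{σ(y)})`" (DEFINED), `act_one`, `act_mul`; `orbit` = all translates of an object (Joshi's
  analogue of a datum "regarded up to indeterminacies"; [Joshi arXiv 2303.01662, Rmk 8.5.2] relates the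
  `Aut(𝒢(𝒪_F))`-enlargement to Mochizuki's (Ind1)); `labeled y` = §4 Cor (chunk p0013) "distinctly labeled
  isomorphs `Π^temp(X/E;K_x)`, `x` a closed point" (the objects `(X, y, id)`), `labeled_injective`.
* §4 `ATSObj.relabel σ` — §8 Prop (pr:belyi) (2) / Cor (chunk p0022): the action of `Aut(Π)` by `α ↦ σ ∘ α`
  (DEFINED for every `X`); `StrictBelyiRigidity` = Prop (pr:belyi) (1) "for every `(Y/E′, E′ ↪ K) ∈
  𝔍_SB(X,E)` one has `Y ≅ X` [as `ℤ`-schemes]" over an ABSTRACT scheme-isomorphism relation on `TemperedCurve`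
  (schemes are behind the interface) — named, never asserted [Mochizuki 2007, absolute Grothendieck conjecture
  for curves of strict Belyi type, as cited by Joshi].

Deliberately NOT here: the construction of `𝒴_{F,E}`, of `𝒢`, or of `ptEquiv` (no Fargues–Fontaine curve in
the tree or Mathlib); Thm (th:main3) (1) "`𝒢̃(𝒪_K) ≅ 𝒢(𝒪_F)`" and (2) (independence of `𝒢`) — statements about
objects not typed here; the Cor. 3.12 vocabulary (dictionary = heading E3, separate file).
-/

noncomputable section

namespace Summit.ABC.IUTFork.Joshi

open Literature.AnabelianGeometry.SemiGraphs (TemperedCurve)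

/-! ## 1. `(G − {0})/𝒪E^*` and the action of linear automorphisms on it -/

section Proj

variable (𝒪E : Type) [CommRing 𝒪E] (G : Type) [AddCommGroup G] [Module 𝒪E G]

/-- The orbit relation of the unit group `𝒪E^*` on the nonzero vectors of an `𝒪E`-module `G` (for
`G = 𝒢(𝒪_F)`: "`(𝒢(𝒪_F) − {0})/𝒪_E^*`", ATS I §8 Thm (th:main3) (3), chunk p0021). [folklore] -/
def unitRel : Setoid {g : G // g ≠ 0} where
  r g h := ∃ u : 𝒪Eˣ, u • (g : G) = h
  iseqv :=
    { refl := fun g => ⟨1, one_smul _ _⟩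
      symm := fun {g h} hu => by
        obtain ⟨u, hu⟩ := hu
        exact ⟨u⁻¹, by rw [← hu, inv_smul_smul]⟩
      trans := fun {g h k} hu hv => by
        obtain ⟨u, hu⟩ := hu
        obtain ⟨v, hv⟩ := hv
        exact ⟨v * u, by rw [mul_smul, hu, hv]⟩ }

/-- `(G − {0})/𝒪E^*` — for `G = 𝒢(𝒪_F)` the right-hand side of Thm (th:main3) (3). [folklore] -/
def ProjPoints : Type := Quotient (unitRel 𝒪E G)

variable {𝒪E G}

/-- A linear automorphism preserves the nonzero vectors. [folklore] -/
def nonzeroMap (σ : G ≃ₗ[𝒪E] G) (g : {g : G // g ≠ 0}) : {g : G // g ≠ 0} :=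
  ⟨σ g, fun h => g.2 ((LinearEquiv.map_eq_zero_iff σ).1 h)⟩

/-- **The action of `Aut_{𝒪E}(G)` on `(G − {0})/𝒪E^*`** (Thm (th:main3) (3), chunk p0021: "for any `σ ∈
Aut_{𝒪_E}(𝒢(𝒪_F))`, `σ` is evidently a bijection on `(𝒢(𝒪_F) − {0})/𝒪_E^*`", proof chunk p0022) — DEFINED: `σ`
commutes with the units, so it descends to the quotient. (Joshi takes TOPOLOGICAL `𝒪_E`-linear automorphisms;
continuity plays no role in the action and is not demanded here.) [claim: Joshi2021ATS1, status: disputed] -/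
def projAct (σ : G ≃ₗ[𝒪E] G) : ProjPoints 𝒪E G → ProjPoints 𝒪E G :=
  Quotient.map' (nonzeroMap σ) fun g h hu => by
    obtain ⟨u, hu⟩ := hu
    refine ⟨u, ?_⟩
    show u • σ (g : G) = σ (h : G)
    rw [← hu, Units.smul_def, Units.smul_def, LinearEquiv.map_smul]

/-- The identity acts trivially. [folklore] -/
theorem projAct_one (x : ProjPoints 𝒪E G) : projAct (1 : G ≃ₗ[𝒪E] G) x = x := by
  induction x using Quotient.inductionOn' with
  | h g => rfl

/-- The action is multiplicative (`σ τ` acts as `σ` after `τ`). [folklore] -/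
theorem projAct_mul (σ τ : G ≃ₗ[𝒪E] G) (x : ProjPoints 𝒪E G) :
    projAct (σ * τ) x = projAct σ (projAct τ x) := by
  induction x using Quotient.inductionOn' with
  | h g => rfl

end Proj

/-! ## 2. The degree-one points of `𝒴_{F,E}`, their residue fields, `𝒢(𝒪_F)` (Thm (th:main3)) -/

/-- SIGNATURE for the perfectoid parametrisation of ATS I §8 (chunks p0021–p0022) and §3 (chunk p0008: untilts
"exist and are parametrized by Fargues–Fontaine curves"), for a FIXED algebraically closed perfectoid field `F`
of characteristic `p` (e.g. `ℂ_p^♭`) and the base field `E ⊇ ℚ_p` with ring of integers `𝒪E`: the set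
`|𝒴_{F,E}|` "of closed points of degree one" with residue fields `K_y` ("algebraically closed, perfectoid with
tilts isometric with `F`", proof of Thm (th:main3) (5), [FarguesFontaine2018]); the Frobenius `φ` ("one has a
canonical identification `|𝒴_{F,E}|/φ^ℤ ≅ |𝒳_{F,E}|`", chunk p0021); for each `y` "a preferred copy of the
algebraic closure" of `E` in `K_y` (chunk p0019) — HERE an embedding of the tree's fixed `AlgebraicClosure
ℚ_[p]`, a CHOICE determined up to `G_{ℚ_p}`, continuous on `ℚ_p`; the topological `𝒪E`-module `𝒢(𝒪_F)` of a
Lubin–Tate formal group `𝒢/𝒪_E` ("naturally a Banach space over `E`", chunk p0021; "the isomorphism class of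
the topological `𝒪_E`-module `𝒢(𝒪_F)` is independent of the choice of the Lubin–Tate `𝒪_E`-formal group", Thm
(th:main3) (2) [LubinTate1965]); and Thm (th:main3) (3) "arising from the natural identification `|𝒴_{F,E}| =
(𝒢(𝒪_F) − {0})/𝒪_E^*`" [FarguesFontaine2018] as the DATUM `ptEquiv`. Pure data: no theorem about the
Fargues–Fontaine curve is built in; the printed assertions are the named `Prop`s below.
[claim: Joshi2021ATS1, status: disputed] -/
structure UntiltPoints (p : ℕ) [Fact p.Prime] (𝒪E : Type) [CommRing 𝒪E] : Type 1 where
  /-- `|𝒴_{F,E}|`: the closed points of degree one -/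
  Pt : Type
  /-- the residue field `K_y` -/
  untilt : Pt → Untilt p
  /-- the Frobenius `φ` on `|𝒴_{F,E}|` -/
  frob : Pt ≃ Pt
  /-- the preferred algebraic closure of `E` inside `K_y`, as an embedding of the tree's `AlgebraicClosure ℚ_[p]` -/
  algCl : ∀ y : Pt, AlgebraicClosure ℚ_[p] →+* (untilt y).K
  /-- … continuous on `ℚ_p` -/
  continuous_algCl : ∀ y : Pt, Continuous fun x : ℚ_[p] => algCl y (algebraMap ℚ_[p] _ x)
  /-- `𝒢(𝒪_F)` -/
  G : Type
  [addCommGroup : AddCommGroup G]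
  [module : Module 𝒪E G]
  [topologicalSpace : TopologicalSpace G]
  /-- Thm (th:main3) (3): `|𝒴_{F,E}| = (𝒢(𝒪_F) − {0})/𝒪_E^*` -/
  ptEquiv : Pt ≃ ProjPoints 𝒪E G

namespace UntiltPoints

attribute [instance] addCommGroup module topologicalSpace

variable {p : ℕ} [Fact p.Prime] {𝒪E : Type} [CommRing 𝒪E] (D : UntiltPoints p 𝒪E)

/-- **`Aut_{𝒪_E}(𝒢(𝒪_F))`** — "the group … of topological automorphisms of the `𝒪_E`-module `𝒢(𝒪_F)`" (Thm (th:main3)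
(3), chunk p0021; (5) and Cor (co:action-on-cpt-cat) quantify over "topological `𝒪_E`-linear automorphism `σ`"): the
CONTINUOUS `𝒪E`-linear automorphisms of `G` (Mathlib `G ≃L[𝒪E] G`, a group under composition). [claim: Joshi2021ATS1, status: disputed] -/
abbrev Aut : Type := D.G ≃L[𝒪E] D.G

/-- **Thm (th:main3) (3)** (chunk p0021): "There is a natural action of the group `Aut_{𝒪_E}(𝒢(𝒪_F))` … on the
set of closed points of degree one of the Fargues–Fontaine curve `𝒴_{F,E}`, arising from the natural
identification `|𝒴_{F,E}| = (𝒢(𝒪_F) − {0})/𝒪_E^*`" — DEFINED by transport of `projAct` (of the underlying linear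
automorphism) along `ptEquiv`. NOT typed: item (4), the induced map on the closed points of `𝒳_{F,E}` "via
`{φⁿ(y)} ↦ {φⁿ(σ(y))}`" (print defines it on representatives `y`; `frob` enters only `FrobPreservesUntilt` here).
[claim: Joshi2021ATS1, status: disputed] -/
def ptAct (σ : D.Aut) (y : D.Pt) : D.Pt := D.ptEquiv.symm (projAct σ.toLinearEquiv (D.ptEquiv y))

/-- The identity automorphism fixes every point. [folklore] -/
theorem ptAct_one (y : D.Pt) : D.ptAct 1 y = y := by
  have h : (1 : D.Aut).toLinearEquiv = 1 := rfl
  simp [ptAct, h, projAct_one]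

/-- `σ τ` acts as `σ` after `τ`. [folklore] -/
theorem ptAct_mul (σ τ : D.Aut) (y : D.Pt) : D.ptAct (σ * τ) y = D.ptAct σ (D.ptAct τ y) := by
  have h : (σ * τ).toLinearEquiv = σ.toLinearEquiv * τ.toLinearEquiv := rfl
  simp [ptAct, h, projAct_mul]

/-- "Thus given any topological `𝒪_E`-linear automorphism `σ` … and a closed point `y ∈ 𝒴_{F,E}` of degree one,
with residue field `K_y`, there is a perfectoid algebraically closed field `σ(K_y) = K_{σ(y)}`" (Thm (th:main3)
(5), chunk p0021): in the typing, the residue field at the moved point. [claim: Joshi2021ATS1, status: disputed] -/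
def movedUntilt (σ : D.Aut) (y : D.Pt) : Untilt p := D.untilt (D.ptAct σ y)

/-- **[KedlayaTemkin2018] as used in ATS I §3** (chunk p0008: "Crucial point for this paper is that there exist
untilts of `ℂ_p^♭` which are not topologically isomorphic. This is the main result of [kedlaya18]"; chunk
p0011: "an uncountable collection"): among the residue fields `K_y` there are two that are not topologically
isomorphic. A named `Prop` on the signature (a published theorem about `F = ℂ_p^♭`; NOT proved or assumed here).
[cite: KedlayaTemkin2018, Thm 1.3] -/
@[cite "KedlayaTemkin2018" "Thm 1.3"]
def ExistsNonIsomorphic : Prop := ∃ y y' : D.Pt, ¬ (D.untilt y).TopIso (D.untilt y')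

/-- "`|𝒴_{F,E}|/φ^ℤ ≅ |𝒳_{F,E}|` given by `y ↦ {φⁿ(y) : n ∈ ℤ}`" (chunk p0021): Frobenius-translates have
(topologically) isomorphic residue fields, so that the closed points of `𝒳_{F,E}` parametrise untilts up to
isomorphism. Named `Prop` (a property of the Fargues–Fontaine curve, [FarguesFontaine2018]); not asserted.
[cite: FarguesFontaine2018, Sec. 2.2] -/
@[cite "FarguesFontaine2018" "Sec. 2.2"]
def FrobPreservesUntilt : Prop := ∀ y : D.Pt, (D.untilt (D.frob y)).TopIso (D.untilt y)

/-- **Joshi: the action changes the topology of the overfield** (ATS I §1, chunk p0005: "the action of the group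
`Aut_{ℤ_p}(𝒢(𝒪_{ℂ_p^♭}))` moves the `ℚ_p`-isomorphism class of the analytic space `(X ×_E K)^an` … by changing
the overfield `K` topologically (in general) while keeping `K^♭ = ℂ_p^♭`"; Thm (th:main3) proof, chunk p0022:
"topological `𝒪_E`-linear automorphisms of `𝒢(𝒪_F)` can be used to change the ring structures in the sense of
Theorem (thm:main2)"): some `σ` moves some point to one with a non-homeomorphic residue field. Named `Prop`,
never asserted. [claim: Joshi2021ATS1, status: disputed] -/
@[claim "Joshi2021ATS1" "disputed"]
def ActionChangesTopology : Prop := ∃ (σ : D.Aut) (y : D.Pt), ¬ (D.untilt (D.ptAct σ y)).TopIso (D.untilt y)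

/-- If the action changes the topology somewhere, non-isomorphic untilts exist (bookkeeping between the two
named `Prop`s). [folklore] -/
theorem existsNonIsomorphic_of_actionChangesTopology (h : D.ActionChangesTopology) : D.ExistsNonIsomorphic := by
  obtain ⟨σ, y, hy⟩ := h
  exact ⟨D.ptAct σ y, y, hy⟩

/-- **DILATATION of valuations between two holomorphic structures** (ATS I §10 (pa:norm-example), chunk p0026, =
§1 chunk p0003: "if one moves from one perfectoid field, say `ℂ_p`, to another algebraically closed perfectoid field
`K` with `K^♭ ≃ ℂ_p^♭`, the valuations of elements such as `p` in the two fields (and also valuations of elements of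
`Q̄_p`) undergo a dilatation or scaling"; the example `K₂ = W(𝒪_{ℂ_p^♭})[1/p]/([t^r] − p)`: "norms on `ℂ_p^♭` differing
by a dilatation by factor `r` on the value groups"): read on the preferred algebraic closures, the absolute value at
`y′` is the `r`-th power of the absolute value at `y` on `Q̄_p`. (Cf. [Joshi arXiv 2303.01662 Thm. 6.9.1]
`v_{K_j}(p) = j²·v_{K_1}(p)`, typed by seat abc-iut-E-t3 as `valuationScaling`.) READING PREDICATE.
[claim: Joshi2021ATS1, status: disputed] -/
@[claim "Joshi2021ATS1" "disputed"]
def IsDilatation (y y' : D.Pt) (r : ℝ) : Prop :=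
  ∀ x : AlgebraicClosure ℚ_[p], ‖D.algCl y' x‖ = ‖D.algCl y x‖ ^ r

/-- **Joshi: the action DILATES valuations** (ATS I §1 chunk p0003 / §10 chunk p0026: "the arithmetic Teichmuller
space `𝔍(X,E)_{ℂ_p^♭}` is equipped with a natural action of `Aut_{ℤ_p}(𝒢(𝒪_{ℂ_p^♭}))` which (in general) also provides
dilatations on the value group of `Q̄_p`"; "important in comparing degrees of arithmetic line bundles"): some `σ`
moves some point to one whose valuation on `Q̄_p` is a NON-TRIVIAL power (`r ≠ 1`) of the original. This is the
valuation-RESCALING content of Joshi's move (plan/E OBJECTS O-003; the feature by which E-PLAN expects the move NOT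
to be realised by log-volume-preserving indeterminacies — a location, tested elsewhere, not here). Named `Prop`,
never asserted. [claim: Joshi2021ATS1, status: disputed] -/
@[claim "Joshi2021ATS1" "disputed"]
def ActionDilates : Prop := ∃ (σ : D.Aut) (y : D.Pt) (r : ℝ), 0 < r ∧ r ≠ 1 ∧ D.IsDilatation y (D.ptAct σ y) r

/-- At every point, `0 < ‖p‖_{K_y} < 1` on the preferred algebraic closure (the embedding is a ring map into a field
with `‖p‖ < 1`). [folklore] -/
theorem norm_algCl_p (y : D.Pt) :
    0 < ‖D.algCl y (p : AlgebraicClosure ℚ_[p])‖ ∧ ‖D.algCl y (p : AlgebraicClosure ℚ_[p])‖ < 1 := by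
  rw [map_natCast]
  refine ⟨norm_pos_iff.2 ?_, (D.untilt y).norm_p_lt_one⟩
  exact_mod_cast (Fact.out : p.Prime).ne_zero

/-- A dilatation by `r ≠ 1` CHANGES the absolute value of `p`: `‖p‖_{K_{y′}} = ‖p‖_{K_y}^r ≠ ‖p‖_{K_y}` (so the move
is not isometric on the constants `ℚ ⊆ Q̄_p` — Joshi's "valuations of elements such as `p` … undergo a
dilatation"). [folklore] -/
theorem norm_p_ne_of_isDilatation {y y' : D.Pt} {r : ℝ} (hr : r ≠ 1) (h : D.IsDilatation y y' r) :
    ‖D.algCl y' (p : AlgebraicClosure ℚ_[p])‖ ≠ ‖D.algCl y (p : AlgebraicClosure ℚ_[p])‖ := by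
  obtain ⟨h0, h1⟩ := D.norm_algCl_p y
  rw [h (p : AlgebraicClosure ℚ_[p])]
  intro heq
  have hlog := congrArg Real.log heq
  rw [Real.log_rpow h0] at hlog
  exact hr ((mul_eq_right₀ (Real.log_ne_zero_of_pos_of_ne_one h0 h1.ne)).1 hlog)

end UntiltPoints

/-! ## 3. `𝔍(X,E)_F`: objects over a point, the action (Thm (th:main3) (6), Cor (co:action-on-cpt-cat)), orbits -/

variable {p : ℕ} [Fact p.Prime] {𝒪E : Type} [CommRing 𝒪E]

/-- **An object of `𝔍(X,E)_F`** (ATS I §8, chunk p0019: "`(Y/E′, E′ ↪ K, ι : K^♭ ≅ F)` … `K` alg. closed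
perfectoid field, `K^♭` isometric to `F` … `Π^temp(Y/E′;K) ≅ Π^temp(X/E)`"), typed OVER A POINT `y ∈ |𝒴_{F,E}|`
of the signature `D`: `K = K_y` (an untilt of `F`, the point playing the role of `ι`), `E′ = Y.K ↪ K_y`
through the preferred algebraic closure `D.algCl y` (so the embedding is not separate data), and the label `α`.
This is the form in which [Joshi, arXiv 2303.01662 Def. 3.2.1 / Def. 6.11.1] and [Joshi, arXiv 2401.13508
Lemma 2.1.6] use the space: a holomorphoid projects to a point `y`. [claim: Joshi2021ATS1, status: disputed] -/
structure ATSObjF (X : TemperedCurve p) (D : UntiltPoints p 𝒪E) : Type 1 where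
  /-- the curve `Y/E′` with its tempered fundamental group -/
  Y : TemperedCurve p
  /-- the point `y` of `𝒴_{F,E}` whose residue field `K_y` is the perfectoid field of the triple -/
  pt : D.Pt
  /-- the tempered anabelomorphism `Π^temp(Y/E′) ≅ Π^temp(X/E)` -/
  α : Y.PiTemp ≃ₜ* X.PiTemp

namespace ATSObjF

variable {X : TemperedCurve p} {D : UntiltPoints p 𝒪E}

/-- The embedding `E′ ↪ K_y` of an object over `y`: `E′ ⊆ Q̄_p` followed by the preferred algebraic closure
in `K_y`. [claim: Joshi2021ATS1, status: disputed] -/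
def emb (A : ATSObjF X D) : A.Y.K →+* (D.untilt A.pt).K := (D.algCl A.pt).comp A.Y.K.val.toRingHom

/-- "there are full subcategories `𝔍(X,E)_F` consisting of `(Y/E′, E′ ↪ K)` such that `K^♭ = F`" (Thm
(th:main4.5) (6), chunk p0022): the object of `𝔍(X,E)` underlying an object of `𝔍(X,E)_F`. [claim: Joshi2021ATS1, status: disputed] -/
def toObj (A : ATSObjF X D) : ATSObj X where
  Y := A.Y
  U := D.untilt A.pt
  emb := A.emb
  continuous_emb := (D.continuous_algCl A.pt).congr fun x => by
    show D.algCl A.pt (algebraMap ℚ_[p] _ x) = D.algCl A.pt (A.Y.K.val (algebraMap ℚ_[p] A.Y.K x))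
    rw [AlgHom.commutes]
  α := A.α

/-- **The action of `Aut_{𝒪_E}(𝒢(𝒪_F))` on `𝔍(X,E)_F`** (Thm (th:main3) (6), chunk p0021; in the explicit form of
§9 Cor (co:action-on-cpt-cat), chunk p0025: "`(Y/E′, E′ ↪ K_y) ↦ (Y/E′, E′ ↪ K_{σ(y)})`" and "on labeled
fundamental groups by `Π^temp(Y/E′;K_y) ↦ Π^temp(Y/E′;K_{σ(y)})`") — DEFINED: the point moves, the curve and the
label stay. (Thm (th:main3) (6) writes `(σ(Y), σ(E′), σ(K))` with `σ(Y)/σ(E′)` "the pull-back of `Y/E′` along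
the isomorphism of discretely valued fields `E′ → σ(E′)`", proof chunk p0022; with `E′` read inside the fixed
`Q̄_p` this is the same object.) Joshi: "the `p`-adic analog of the action of the Virasoro algebra" (chunk
p0022). [claim: Joshi2021ATS1, status: disputed] -/
def act (σ : D.Aut) (A : ATSObjF X D) : ATSObjF X D := ⟨A.Y, D.ptAct σ A.pt, A.α⟩

/-- The identity acts trivially. [folklore] -/
theorem act_one (A : ATSObjF X D) : act 1 A = A := by cases A; simp [act, UntiltPoints.ptAct_one]

/-- `σ τ` acts as `σ` after `τ`. [folklore] -/
theorem act_mul (σ τ : D.Aut) (A : ATSObjF X D) : act (σ * τ) A = act σ (act τ A) := by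
  simp [act, UntiltPoints.ptAct_mul]

/-- The action keeps `Y/E′` and the label `α` ("the fundamental groups stay fixed", §1 chunk p0003); only the
perfectoid field moves: `(act σ A).toObj.U = K_{σ(y)}`. [folklore] -/
theorem act_untilt (σ : D.Aut) (A : ATSObjF X D) : (act σ A).toObj.U = D.movedUntilt σ A.pt := rfl

/-- **The orbit of an object under `Aut_{𝒪_E}(𝒢(𝒪_F))`**: all its translates — Joshi's analogue of a datum
"regarded up to indeterminacies" (for the comparison with Mochizuki's (Ind1) see [Joshi, arXiv 2303.01662,
Rmk. 8.5.2]; the dictionary itself is NOT typed here). [claim: Joshi2021ATS1, status: disputed] -/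
def orbit (A : ATSObjF X D) : Set (ATSObjF X D) := {B | ∃ σ : D.Aut, B = act σ A}

/-- An object lies in its own orbit; translates lie in the orbit. [folklore] -/
theorem mem_orbit_self (A : ATSObjF X D) : A ∈ orbit A := ⟨1, (act_one A).symm⟩

/-- Under `ActionChangesTopology`, some object of `𝔍(X,E)_F` has a translate that is NOT isomorphic to it in
`𝔍(X,E)` — the typed content of "the action … moves the `ℚ_p`-isomorphism class" (chunk p0005) for the objects
`(X, y, id)`. [claim: Joshi2021ATS1, status: disputed] -/
theorem exists_act_not_isIso (X : TemperedCurve p) (h : D.ActionChangesTopology) :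
    ∃ (A : ATSObjF X D) (σ : D.Aut), ¬ (act σ A).toObj.IsIso A.toObj := by
  obtain ⟨σ, y, hy⟩ := h
  exact ⟨⟨X, y, ContinuousMulEquiv.refl _⟩, σ, ATSObj.not_isIso_of_not_topIso hy⟩

variable (X D) in
/-- **§4 Cor (chunk p0013)**: "the natural function `K ↦ Π^temp(X/E;K)` … provides a distinguished collection of
distinctly labeled isomorphs `{Π^temp(X/E;K_x) : x ∈ 𝒳_{F,E} a closed point with residue field K_x}` of the
tempered fundamental group" — the objects `(X/E, E ↪ K_y, id)` of `𝔍(X,E)_F`, one for each point.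
[claim: Joshi2021ATS1, status: disputed] -/
def labeled (y : D.Pt) : ATSObjF X D := ⟨X, y, ContinuousMulEquiv.refl _⟩

/-- Distinct points give distinct labeled isomorphs ("distinctly labeled"). [folklore] -/
theorem labeled_injective : Function.Injective (labeled X D) := fun _ _ h => congrArg ATSObjF.pt h

/-- The action permutes the labeled isomorphs: `σ · (X, y, id) = (X, σ(y), id)` (Cor (co:action-on-cpt-cat), "on
labeled fundamental groups"). [folklore] -/
theorem act_labeled (σ : D.Aut) (y : D.Pt) : act σ (labeled X D y) = labeled X D (D.ptAct σ y) := rfl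

/-- With [KedlayaTemkin2018] (`ExistsNonIsomorphic`) the space `𝔍(X,E)` is a NON-TRIVIAL anabelian variation
(two labeled isomorphs with non-homeomorphic residue fields) — Joshi's conclusion of §7–§8, here CONDITIONAL on
the named `Prop`. [claim: Joshi2021ATS1, status: disputed] -/
theorem not_isTrivial_of_existsNonIsomorphic (X : TemperedCurve p) (h : D.ExistsNonIsomorphic) :
    ¬ (ATSObj.variation X).IsTrivial := by
  obtain ⟨y, y', hyy'⟩ := h
  exact ATSObj.not_isTrivial_of_exists_not_topIso X ⟨(labeled X D y).toObj, (labeled X D y').toObj, hyy'⟩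

end ATSObjF

/-! ## 4. The `Aut(Π)`-action by relabelling (Prop (pr:belyi), Cor of §8) -/

namespace ATSObj

variable {X : TemperedCurve p}

/-- **Relabelling by an automorphism of `Π = Π^temp(X/E)`**: `(Y/E′, E′ ↪ K, α) ↦ (Y/E′, E′ ↪ K, σ ∘ α)` — the
action of `Aut(Π)` of §8 Prop (pr:belyi) (2) (chunk p0020: "one has a natural action of `Aut(Π)` on
`𝔍_SB(X,E)` via its action on `Isom(Y,X) ≅ Isom^out(π₁(Y), π₁(X))`") read on the labels; DEFINED for every `X`
(for `X` of strict Belyi type Joshi's point (1), `StrictBelyiRigidity`, makes all `Y` isomorphic to `X` as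
schemes, so that this is an action by automorphisms of ONE scheme). [claim: Joshi2021ATS1, status: disputed] -/
def relabel (σ : X.PiTemp ≃ₜ* X.PiTemp) (A : ATSObj X) : ATSObj X :=
  { A with α := A.α.trans σ }

/-- Relabelling by the identity. [folklore] -/
theorem relabel_refl (A : ATSObj X) : relabel (ContinuousMulEquiv.refl _) A = A := by
  cases A; rfl

/-- Relabelling is an action: `σ` then `τ` is relabelling by `σ` followed by `τ`. [folklore] -/
theorem relabel_trans (σ τ : X.PiTemp ≃ₜ* X.PiTemp) (A : ATSObj X) :
    relabel (σ.trans τ) A = relabel τ (relabel σ A) := by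
  cases A; rfl

/-- Relabelling does not change the perfectoid field (forgetful functor to perfectoid fields). [folklore] -/
theorem relabel_U (σ : X.PiTemp ≃ₜ* X.PiTemp) (A : ATSObj X) : (relabel σ A).U = A.U := rfl

/-- **§8 Prop (pr:belyi) (1)** (chunk p0020): "Let `X/E` be a geometrically connected, smooth, quasi-projective,
hyperbolic curve of Strict Belyi Type over `E`. Then for every `(Y/E′, E′ ↪ K) ∈ 𝔍_SB(X,E)` one has an
isomorphism of schemes (over `ℤ`) `Y ≅ X`" (from Mochizuki's absolute Grothendieck conjecture for such curves,
[Mochizuki 2007] as cited there). The schemes are behind the `TemperedCurve` interface, so this is typed over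
an ABSTRACT relation `IsoSch` ("isomorphic as `ℤ`-schemes") and an abstract predicate `IsSB` ("of strict Belyi
type", [Mochizuki, Topics II] as cited): named `Prop`, never asserted. [claim: Joshi2021ATS1, status: disputed] -/
@[claim "Joshi2021ATS1" "disputed"]
def StrictBelyiRigidity (IsSB : TemperedCurve p → Prop) (IsoSch : TemperedCurve p → TemperedCurve p → Prop)
    (X : TemperedCurve p) : Prop :=
  IsSB X → ∀ A : ATSObj X, IsSB A.Y → IsoSch A.Y X

end ATSObj

end Summit.ABC.IUTFork.Joshi

end
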